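import Mathlib
import HarnessLib
import Literature.Probability.Percolation.WalkExcursionDecomposition
import Summits.CriticalPhenomena.Ising3DConformalLimit.Theses.ArmDressing
import Summits.CriticalPhenomena.Ising3DConformalLimit.Theorems.ArmDressingEvenPatternDecouplingPatternTransferDet

/-!
# `ArmDressing.EvenPatternDecoupling` — stub `stub_ballReadingTransferDet` (deterministic transfer)

Support file for crux item stmt-CriticalPhenomena-16133 (line `registered`, skeleton revision 4):
the registered stub `stub_ballReadingTransferDet` of the line skeleton, proved. It is the
`s`-ball analogue of conjunct (d) of the landed `stub_patternTransferDet`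
(`ArmDressingEvenPatternDecouplingPatternTransferDet`): the crossing clusters of the annuli are
read at a READING family of closed balls `B̄(b'_j, t_j) ⊆ B(c_j, r_j)`, while the arms start from
an inner family `B̄(b_j, s_j) ⊆ B̄(b'_j, t_j)`. On box-supported bond configurations, for a mesh
`δ < δ₀(c, r, b', t)` and every volume: (c) `EVEN2 ∩ CROSS ⊆ CROSS` for the `s`-ball family;
(d) given the `s`-ball arms and uniqueness of the crossing clusters read at `(b', t)`,
`EVEN2 ∩ CROSS` of the `s`-ball family coincides with the parity pattern `Patt` read at `(b', t)`.
The walk surgery is the generic excursion decomposition of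
`Literature.Probability.Percolation.WalkExcursionDecomposition`, here in the sub-inner form
`reachable_subInner_iff_crs` (arms and endpoints in sub-inner sets `S k ⊆ I k`); the metric side
conditions and the parity bookkeeping are the helper lemmas of the landed file.
-/

namespace Summit.CriticalPhenomena.Ising3DConformalLimit.Theorems.EvenPatternDecoupling

open scoped Topology
open Filter Set Metric
open Literature.Probability.LatticeModels Literature.Probability.Percolation
  Literature.Barriers.CriticalPhenomena

/-- **Sub-inner pattern = crossing-cluster pattern.** The sub-inner form of
`Literature.Probability.Percolation.reachable_inner_iff_crs`: for sub-inner sets `S k ⊆ I k`,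
given an arm from every `S k` to its far set `F k` and uniqueness of the crossing clusters (read
at the inner sets `I k`), `S i` and `S j` are `G`-joined iff some crossing sites of `i` and `j`
are `R`-joined. -/
theorem reachable_subInner_iff_crs {V ι : Type*} {G H R : SimpleGraph V} {I F : ι → Set V}
    {O : Set V} {Crs : ι → V → Prop} (hGH : G ≤ H) (hRG : R ≤ G)
    (hR : ∀ ⦃a b : V⦄, G.Adj a b → a ∈ O → b ∈ O → R.Adj a b)
    (hO : ∀ x, x ∈ O ↔ ∀ k, x ∉ I k) (hIF : ∀ k x, x ∈ I k → x ∈ F k → False)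
    (hfar : ∀ ⦃k m : ι⦄, k ≠ m → I m ⊆ F k)
    (hrim : ∀ ⦃k m : ι⦄, k ≠ m → ∀ ⦃x y : V⦄, H.Adj x y → y ∈ I m → x ∈ F k)
    (hCrs : ∀ k x, Crs k x ↔
      x ∈ O ∧ (∃ y, y ∈ I k ∧ H.Adj x y) ∧ ∃ y, y ∈ O ∧ y ∈ F k ∧ R.Reachable x y)
    (hUni : ∀ k x x', Crs k x → Crs k x' → R.Reachable x x')
    (S : ι → Set V) (hS : ∀ k, S k ⊆ I k)
    (harm : ∀ k, ∃ x y, x ∈ S k ∧ y ∈ F k ∧ G.Reachable x y) (i j : ι) :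
    (∃ x y, x ∈ S i ∧ y ∈ S j ∧ G.Reachable x y) ↔
      ∃ x x', Crs i x ∧ Crs j x' ∧ R.Reachable x x' := by
  classical
  -- every sub-inner set is `G`-joined to a crossing site of its index (the arm passes one)
  have hpt : ∀ k, ∃ u a, u ∈ S k ∧ Crs k a ∧ G.Reachable u a := by
    intro k
    obtain ⟨u, y, hu, hyF, ⟨W⟩⟩ := harm k
    obtain ⟨a, ha, hCa⟩ :=
      exists_crs_mem_support_of_walk_far hGH hR hO hIF hrim hCrs W (hS k hu) hyF
    exact ⟨u, a, hu, hCa, ⟨W.takeUntil a ha⟩⟩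
  constructor
  · rintro ⟨u, v, hu, hv, ⟨W⟩⟩
    by_cases hij : i = j
    · subst hij
      obtain ⟨-, a, -, hCa, -⟩ := hpt i
      exact ⟨a, a, hCa, hCa, SimpleGraph.Reachable.refl _⟩
    · obtain ⟨a, x', hCa, hCx', hax⟩ :=
        exists_crs_pair_of_walk hGH hR hO hIF hfar hrim hCrs hUni hij W (hS i hu) (hS j hv)
      exact ⟨x', a, hCx', hCa, hax.symm⟩
  · rintro ⟨x, x', hx, hx', hxx'⟩
    obtain ⟨u, a, hu, hCa, hPa⟩ := hpt i
    obtain ⟨u', a', hu', hCa', hPa'⟩ := hpt j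
    exact ⟨u, u', hu, hu', hPa.trans
      ((((hUni i a x hCa hx).trans hxx').trans (hUni j x' a' hx' hCa')).mono hRG)
        |>.trans hPa'.symm⟩

-- lint debt by design: the registered signature carries unused `let`-binders (`μ`, `PrL`, `Pr`, …); the header
-- below is the registered stub signature = line 126 of the line skeleton with whitespace compressed (token-identical)
set_option linter.unusedVariables false in
/-- **Stub `stub_ballReadingTransferDet` of the line skeleton of crux `EvenPatternDecoupling`
(deterministic, proved): the ball pattern is read on the crossing clusters of the reading
annuli.** For outer data `(c, r)`, an admissible reading family `(b', t)`, an inner family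
`(b, s)` with `B̄(b_j, s_j) ⊆ B̄(b'_j, t_j)`, every mesh `δ < δ₀(c, r, b', t)`, eventually in the
volume `L`, and every configuration `ω` supported on the box edges: (c) `EVEN2 ∩ CROSS ⊆ CROSS`
for the `s`-ball family; (d) given the `s`-ball arms and uniqueness of the crossing clusters read
at `(b', t)`, `EVEN2 ∩ CROSS` of the `s`-ball family `↔ Patt` read at `(b', t)`. -/
theorem stub_ballReadingTransferDet : open Literature.Probability.LatticeModels Literature.Probability.Percolation Literature.Barriers.CriticalPhenomena Filter Topology in let E3:=EuclideanSpace ℝ (Fin 3); let μ : (L : ℕ)→MeasureTheory.Measure (BondConfig (BoxV 3 L)):=fun L=>rcMeasure (boxGraph 3 L) (fkIsingParam (criticalBeta 3)) 2 (boxBoundary 3 L); let PrL : (m : ℕ)→(Fin m→Set (Site 3))→Set (Fin m→Fin m→Prop)→ℕ→ℝ:=fun _ K R L=>(μ L).real {ω | (fun i j=>∃ x y : BoxV 3 L, x.1∈K i∧y.1∈K j∧(openGraph ω).Reachable x y)∈R}; let Pr : (m : ℕ)→(Fin m→Set (Site 3))→Set (Fin m→Fin m→Prop)→ℝ:=fun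 m K R=>limUnder atTop (PrL m K R); let mesh : ℝ→Site 3→E3:=fun δ z=>WithLp.toLp 2 fun i : Fin 3=>δ * (z i : ℝ); let disc : ℝ→Set E3→Set (Site 3):=fun δ A=>{x | mesh δ x∈A}; let EVEN : (n : ℕ)→Set (Fin n→Fin n→Prop):=fun n=>{R | ∀ i, Even ({j : Fin n | R i j}.ncard)}; let EVEN2 : (n : ℕ)→Set (Fin (n + n)→Fin (n + n)→Prop):=fun n=>{R | ∀ i : Fin n, Even ({j : Fin n | R (Fin.castAdd n i) (Fin.castAdd n j)}.ncard)}; let CROSS : (n : ℕ)→Set (Fin (n + n)→Fin (n + n)→Prop):=fun n=>{R | ∀ i : Fin n, R (Fin.castAdd n i) (Fin.natAdd n i)}; let pts : (n : ℕ)→ℝ→(Fin n→E3)→(Fin n→Set (Site 3)):=fun _ δ z j=>{latticeApprox δ (z j)}; let fam : (n : ℕ)→ℝ→(Fin n→Set E3)→(Fin n→Set E3)→(Fin (n + n)→Set (Site 3)):=fun _ δ A B=>Fin.append (fun j=>disc δ (A j)) (fun j=>disc δ (B j)); let Supp : (L : ℕ)→Set (BondConfig (BoxV 3 L)):=fun L=>{ω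 | ω⊆(boxGraph 3 L).edgeSet}; let Ev : (m : ℕ)→(Fin m→Set (Site 3))→Set (Fin m→Fin m→Prop)→(L : ℕ)→Set (BondConfig (BoxV 3 L)):=fun _ K R L=>{ω | (fun i j=>∃ x y : BoxV 3 L, x.1∈K i∧y.1∈K j∧(openGraph ω).Reachable x y)∈R}; let Out : (n : ℕ)→ℝ→(Fin n→E3)→(Fin n→ℝ)→(L : ℕ)→Set (BoxV 3 L):=fun _ δ b s L=>{x | ∀ k, mesh δ x.1∉Metric.closedBall (b k) (s k)}; let RO : (L : ℕ)→BondConfig (BoxV 3 L)→Set (BoxV 3 L)→BoxV 3 L→BoxV 3 L→Prop:=fun L ω O x y=>(SimpleGraph.fromRel fun a a' : BoxV 3 L=>s(a, a')∈ω∧a∈O∧a'∈O).Reachable x y; let Crs : (n : ℕ)→ℝ→(Fin n→E3)→(Fin n→ℝ)→(Fin n→E3)→(Fin n→ℝ)→(L : ℕ)→BondConfig (BoxV 3 L)→Fin n→BoxV 3 L→Prop:=fun n δ c r b s L ω j x=>x∈Out n δ b s L∧(∃ y : BoxV 3 L, mesh δ y.1∈Metric.closedBall (b j) (s j)∧(boxGraph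 3 L).Adj x y)∧(∃ y : BoxV 3 L, y∈Out n δ b s L∧mesh δ y.1∈(Metric.ball (c j) (r j))ᶜ∧RO L ω (Out n δ b s L) x y); let Uni : (n : ℕ)→ℝ→(Fin n→E3)→(Fin n→ℝ)→(Fin n→E3)→(Fin n→ℝ)→(L : ℕ)→Set (BondConfig (BoxV 3 L)):=fun n δ c r b s L=>{ω | ∀ (j : Fin n) (x x' : BoxV 3 L), Crs n δ c r b s L ω j x→Crs n δ c r b s L ω j x'→RO L ω (Out n δ b s L) x x'}; let Patt : (n : ℕ)→ℝ→(Fin n→E3)→(Fin n→ℝ)→(Fin n→E3)→(Fin n→ℝ)→(L : ℕ)→Set (BondConfig (BoxV 3 L)):=fun n δ c r b s L=>{ω | (fun i j=>∃ x x' : BoxV 3 L, Crs n δ c r b s L ω i x∧Crs n δ c r b s L ω j x'∧RO L ω (Out n δ b s L) x x')∈EVEN n}; ∀ (n : ℕ) (c : Fin n→E3) (r : Fin n→ℝ), (∀ j, 0 < r j)→(∀ j k, j ≠ k→Disjoint (Metric.closedBall (c j) (r j)) (Metric.closedBall (c k) (r k)))→∀ (b' : Fin n→E3) (t : Fin n→ℝ),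 (∀ j, 0 < t j)→(∀ j, Metric.closedBall (b' j) (t j)⊆Metric.ball (c j) (r j))→∀ (b : Fin n→E3) (s : Fin n→ℝ), (∀ j, 0 < s j)→(∀ j, Metric.closedBall (b j) (s j)⊆Metric.closedBall (b' j) (t j))→∃ δ₀ : ℝ, 0 < δ₀∧∀ δ : ℝ, 0 < δ→δ < δ₀→∀ᶠ L in atTop, ∀ ω : BondConfig (BoxV 3 L), ω∈Supp L→(ω∈Ev (n + n) (fam n δ (fun j=>Metric.closedBall (b j) (s j)) (fun j=>(Metric.ball (c j) (r j))ᶜ)) (EVEN2 n ∩ CROSS n) L→ω∈Ev (n + n) (fam n δ (fun j=>Metric.closedBall (b j) (s j)) (fun j=>(Metric.ball (c j) (r j))ᶜ)) (CROSS n) L)∧(ω∈Ev (n + n) (fam n δ (fun j=>Metric.closedBall (b j) (s j)) (fun j=>(Metric.ball (c j) (r j))ᶜ)) (CROSS n) L→ω∈Uni n δ c r b' t L→(ω∈Ev (n + n) (fam n δ (fun j=>Metric.closedBall (b j) (s j)) (fun j=>(Metric.ball (c j) (r j))ᶜ)) (EVEN2 n ∩ CROSS n) L↔ω∈Patt n δ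 c r b' t L)) := by
  intro E3 μ PrL Pr mesh disc EVEN EVEN2 CROSS pts fam Supp Ev Out RO Crs Uni Patt n c r hr hd b' t ht
    hadm b s hs hsub
  -- positive slack between each reading ball and its outer ball
  have hslack : ∀ j, ∃ e : ℝ, 0 < e ∧
      cthickening e (closedBall (b' j) (t j)) ⊆ ball (c j) (r j) := fun j =>
    (isCompact_closedBall (b' j) (t j)).exists_cthickening_subset_open isOpen_ball (hadm j)
  choose e he hesub using hslack
  -- the mesh threshold: lattice neighbours of a reading ball stay inside its outer ball
  obtain ⟨δ₀, hδ₀, hδ₀P⟩ : ∃ δ₀ : ℝ, 0 < δ₀ ∧ ∀ δ : ℝ, 0 < δ → δ < δ₀ → ∀ j, 2 * δ ≤ e j := by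
    have hev : ∀ᶠ δ : ℝ in 𝓝 0, ∀ j, 2 * δ ≤ e j := by
      refine Filter.eventually_all.2 fun j => ?_
      have h1 : (0 : ℝ) < e j / 2 := by linarith [he j]
      filter_upwards [eventually_lt_nhds h1] with δ hδ
      linarith
    obtain ⟨δ₀, hδ₀, h⟩ := Metric.eventually_nhds_iff.1 hev
    exact ⟨δ₀, hδ₀, fun δ hδ hδlt j => h (by rwa [Real.dist_eq, sub_zero, abs_of_pos hδ]) j⟩
  refine ⟨δ₀, hδ₀, fun δ hδ hδlt => Filter.Eventually.of_forall fun L ω hω => ?_⟩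
  have hδj := hδ₀P δ hδ hδlt
  -- the generic excursion-decomposition framework on `BoxV 3 L`, inner sets = reading balls
  have hω' : ω ⊆ (boxGraph 3 L).edgeSet := hω
  have hGH : openGraph ω ≤ boxGraph 3 L := fun a a' h =>
    (boxGraph 3 L).mem_edgeSet.1 (hω' ((openGraph_adj ω a a').1 h).1)
  have hRG : (SimpleGraph.fromRel fun a a' : BoxV 3 L =>
      s(a, a') ∈ ω ∧ a ∈ Out n δ b' t L ∧ a' ∈ Out n δ b' t L) ≤ openGraph ω := by
    intro a a' h
    rw [SimpleGraph.fromRel_adj] at h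
    rw [openGraph_adj]
    rcases h with ⟨hne, h | h⟩
    · exact ⟨h.1, hne⟩
    · exact ⟨by rw [Sym2.eq_swap]; exact h.1, hne⟩
  have hR : ∀ ⦃a a' : BoxV 3 L⦄, (openGraph ω).Adj a a' → a ∈ Out n δ b' t L →
      a' ∈ Out n δ b' t L → (SimpleGraph.fromRel fun a a' : BoxV 3 L =>
        s(a, a') ∈ ω ∧ a ∈ Out n δ b' t L ∧ a' ∈ Out n δ b' t L).Adj a a' :=
    fun a a' h ha ha' => (SimpleGraph.fromRel_adj _ _ _).2
      ⟨h.ne, Or.inl ⟨((openGraph_adj ω a a').1 h).1, ha, ha'⟩⟩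
  have hO : ∀ x : BoxV 3 L, x ∈ Out n δ b' t L ↔
      ∀ k, x ∉ (fun k => {x : BoxV 3 L | mesh δ x.1 ∈ closedBall (b' k) (t k)}) k :=
    fun x => Iff.rfl
  have hIF : ∀ (k : Fin n) (x : BoxV 3 L),
      x ∈ (fun k => {x : BoxV 3 L | mesh δ x.1 ∈ closedBall (b' k) (t k)}) k →
      x ∈ (fun k => {x : BoxV 3 L | mesh δ x.1 ∈ (ball (c k) (r k))ᶜ}) k → False :=
    fun k x hx hF => hF (hadm k hx)
  have hfar : ∀ ⦃k m : Fin n⦄, k ≠ m →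
      (fun k => {x : BoxV 3 L | mesh δ x.1 ∈ closedBall (b' k) (t k)}) m ⊆
      (fun k => {x : BoxV 3 L | mesh δ x.1 ∈ (ball (c k) (r k))ᶜ}) k :=
    fun k m hkm x hx => not_mem_ball_of_mem_inner hx (hadm m) (hd m k (Ne.symm hkm))
  have hrim : ∀ ⦃k m : Fin n⦄, k ≠ m → ∀ ⦃x y : BoxV 3 L⦄, (boxGraph 3 L).Adj x y →
      y ∈ (fun k => {x : BoxV 3 L | mesh δ x.1 ∈ closedBall (b' k) (t k)}) m →
      x ∈ (fun k => {x : BoxV 3 L | mesh δ x.1 ∈ (ball (c k) (r k))ᶜ}) k :=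
    fun k m hkm x y hxy hy => not_mem_ball_of_near_inner hy (dist_mesh_le_of_adj hδ.le hxy)
      (hδj m) (hesub m) (hd m k (Ne.symm hkm))
  have hCrs : ∀ (k : Fin n) (x : BoxV 3 L), Crs n δ c r b' t L ω k x ↔
      x ∈ Out n δ b' t L ∧
      (∃ y, y ∈ (fun k => {x : BoxV 3 L | mesh δ x.1 ∈ closedBall (b' k) (t k)}) k ∧
        (boxGraph 3 L).Adj x y) ∧
      ∃ y, y ∈ Out n δ b' t L ∧
        y ∈ (fun k => {x : BoxV 3 L | mesh δ x.1 ∈ (ball (c k) (r k))ᶜ}) k ∧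
        (SimpleGraph.fromRel fun a a' : BoxV 3 L =>
          s(a, a') ∈ ω ∧ a ∈ Out n δ b' t L ∧ a' ∈ Out n δ b' t L).Reachable x y :=
    fun k x => Iff.rfl
  refine ⟨fun h => h.2, fun hB huni => ?_⟩
  -- (d) given the `s`-ball arms and uniqueness at `(b', t)`, ball pattern = crossing pattern
  have happL : ∀ i, fam n δ (fun j => closedBall (b j) (s j)) (fun j => (ball (c j) (r j))ᶜ)
      (Fin.castAdd n i) = disc δ (closedBall (b i) (s i)) := fun i => Fin.append_left _ _ i
  have happR : ∀ i, fam n δ (fun j => closedBall (b j) (s j)) (fun j => (ball (c j) (r j))ᶜ)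
      (Fin.natAdd n i) = disc δ (ball (c i) (r i))ᶜ := fun i => Fin.append_right _ _ i
  have harm : ∀ k, ∃ x y : BoxV 3 L,
      x ∈ (fun k => {x : BoxV 3 L | mesh δ x.1 ∈ closedBall (b k) (s k)}) k ∧
      y ∈ (fun k => {x : BoxV 3 L | mesh δ x.1 ∈ (ball (c k) (r k))ᶜ}) k ∧
      (openGraph ω).Reachable x y := by
    intro k
    obtain ⟨x, y, hx, hy, hxy⟩ := hB k
    rw [happL] at hx
    rw [happR] at hy
    exact ⟨x, y, hx, hy, hxy⟩
  have hS : ∀ k, (fun k => {x : BoxV 3 L | mesh δ x.1 ∈ closedBall (b k) (s k)}) k ⊆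
      (fun k => {x : BoxV 3 L | mesh δ x.1 ∈ closedBall (b' k) (t k)}) k :=
    fun k x hx => hsub k hx
  have key : ∀ i j, (∃ x y : BoxV 3 L,
      x.1 ∈ fam n δ (fun j => closedBall (b j) (s j)) (fun j => (ball (c j) (r j))ᶜ)
        (Fin.castAdd n i) ∧
      y.1 ∈ fam n δ (fun j => closedBall (b j) (s j)) (fun j => (ball (c j) (r j))ᶜ)
        (Fin.castAdd n j) ∧ (openGraph ω).Reachable x y) ↔
      ∃ x x' : BoxV 3 L, Crs n δ c r b' t L ω i x ∧
        Crs n δ c r b' t L ω j x' ∧ RO L ω (Out n δ b' t L) x x' := by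
    intro i j
    rw [happL i, happL j]
    exact reachable_subInner_iff_crs hGH hRG hR hO hIF hfar hrim hCrs huni _ hS harm i j
  exact mem_even2_iff_of_forall_iff key hB

end Summit.CriticalPhenomena.Ising3DConformalLimit.Theorems.EvenPatternDecoupling
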